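import Summits.BirchSwinnertonDyer.Rank1Residual.X2.CongruenceTransferCoveredNonsplit
import Summits.BirchSwinnertonDyer.Rank1Residual.X2.ClassClosureO9
import HarnessLib

/-!
# Class X2, ROUTE G WITH A COVERED PARTNER AT RANK ONE: non-split X2c pair + covered good relative
# + λ-certificate + Schneider certificate ⟹ `BSD(E₀, p)` (cell `b2b-bsdres`, lane CLASS-CLOSURE,
# seat `cc-typer-6`; companion of eisenstein-p2's `X2/CongruenceTransferCoveredNonsplit.lean`)

HONEST FRAMING (run/shared/lean/b2b/bsd-rank1-residual/, verbatim in every file): the goal of the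
cell is to DELETE the COMBINATION-SHAPED residual classes of the Birch–Swinnerton-Dyer formula for
ALL analytic-rank `≤ 1` elliptic curves over `ℚ` — "full BSD formula for every rank `≤ 1` curve in
class `C`" assembled STRICTLY from published theorems — so that the rank-`≤ 1` remainder becomes
exactly the CONSTRUCTION-SHAPED classes, which are TYPED (missing-input `Prop`s), NOT attempted.
This is not "finishing BSD". Research routes; NO CLAIM BEYOND STATED CLASSES; nothing here changes
a label; X2c stays CONSTRUCTION-SHAPED. ONE THEOREM (no definition, no named fact): every published
theorem enters as one of the tree's existing named Literature facts BY NAME; the λ-certificates and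
the Schneider certificate are PER-PAIR hypotheses.

Eisenstein-p2's route G (gen 14) transfers Mazur's main conjecture to a NON-split multiplicative
Eisenstein pair `(E₀, p)` from a congruent COVERED good non-anomalous relative `E₀'`
(`mazurMainConjectureAt_of_coveredRelative_of_not_split`: CGS 2025 Thm. A on the relative, Wuthrich
2014 Thm. 16, GV 2000 §§1–2 at `p ‖ N`, Tate) and closed the RANK-ZERO pairs
(`bsdp_of_coveredRelative_rankZero_of_not_split`). With the rank-one leading term at a non-split
prime now PUBLISHED (Disegni 2020 Thm. 4, `Disegni2020.padicBSD_rankOne_nonsplitMult`, p249273) and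
the kernel step `X2.bsdp_of_cellC_of_not_split_of_mazurMainConjectureAt_of_schneider` (p249649), the
same route closes RANK-ONE pairs modulo the pair's Schneider certificate:
`bsdp_of_coveredRelative_rankOne_of_not_split` — the transport lemma of CLASS-CLOSURE-PLAN §3.7 E3
("level-lowering congruence to the CLOSED partner, transport lemma = Greenberg–Vatsal-type for
`r = 1`") in the kernel. Census pointer (eisenstein-p2 route G): 224 / 254 non-split X2 window pairs at
`3` have a covered partner below 2·10⁴ (both ranks). Nothing is booked; per pair the inputs are the
two `(μ, λ)` certificates, the torsion isomorphism, the bad-prime set `S₀` with its `δ`-shift, and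
`Reg_p(E₀, Dh) ≠ 0`.

References: [CastellaGrossiSkinner2025] Thm. A; [GreenbergVatsal2000] Thm. (1.4), §1 (5)–(7), §2;
[Wuthrich2014] Thm. 16; [Disegni2020] Thm. 4; [SteinWuthrich2013] Thm. 6.1, §4.2; [Miller2011LMS] Def. 1.1.
-/

set_option autoImplicit false

noncomputable section

open scoped Classical MatrixGroups ModularForm

open PowerSeries CongruenceSubgroup WeierstrassCurve NumberField IsDedekindDomain
  Literature.NumberTheory.EllipticCurves
  Literature.NumberTheory.EllipticCurves.ModularForms
  Literature.NumberTheory.EllipticCurves.Rank1Residual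
  Literature.NumberTheory.EllipticCurves.Rank1Residual.Typed
  Literature.NumberTheory.EllipticCurves.Wuthrich2014
  Literature.NumberTheory.EllipticCurves.SteinWuthrich2013
  Literature.NumberTheory.EllipticCurves.Greenberg1999
  Literature.NumberTheory.EllipticCurves.GreenbergVatsal2000
  Literature.NumberTheory.EllipticCurves.CastellaGrossiSkinner2025
  Literature.NumberTheory.EllipticCurves.Disegni2020
  Summit.BirchSwinnertonDyer.BirchSwinnertonDyer.Theorems.Rank1ResidualX1Defs
  Summit.BirchSwinnertonDyer.Rank1Residual.X1.MuLambda
  Summit.BirchSwinnertonDyer.Rank1Residual.X1.MuPart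
  Summit.BirchSwinnertonDyer.Rank1Residual.X1.ParitySqueeze
  Summit.BirchSwinnertonDyer.Rank1Residual.X1.TamagawaSqueeze
  Summit.BirchSwinnertonDyer.Rank1Residual.X1.CongruenceTransfer
  Summit.BirchSwinnertonDyer.Rank1Residual.X2.CongruentLambdaShiftMultiplicative

namespace Summit.BirchSwinnertonDyer.Rank1Residual.X2

section NonSplitRankOne

variable {W W' : WeierstrassCurve ℚ} [W.IsElliptic] [W.IsGloballyMinimal]
  [W'.IsElliptic] [W'.IsGloballyMinimal] {p : ℕ} [Fact p.Prime]
  (S₀ : Finset (HeightOneSpectrum (𝓞 ℚ)))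

/-- **NON-SPLIT X2c pair (rank ONE), COVERED relative, shift DERIVED, Schneider certificate ⇒
`BSD(E₀, p)`** — the rank-one twin of `bsdp_of_coveredRelative_rankZero_of_not_split`: Mazur's main
conjecture at `(E₀,p)` by route G (`mazurMainConjectureAt_of_coveredRelative_of_not_split`: CGS 2025
Thm. A `hA` on the good non-anomalous relative `E₀'` with `E₀[p] ≅ E₀'[p]` (`hiso`), Wuthrich Thm. 16
(`hWu`, `hW16`), Tate (`hT`, `hT'`), GV 2000 §§1–2 at `p ‖ N` (`hAm`, `hBm`, `hF`, `hGV`, `hA7`, `hB`),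
the per-pair analytic `(μ, λ)` certificates of both curves and the `δ`-shift over `S₀`), then the
rank-one leading terms — Disegni 2020 Thm. 4 (`hDis`) and Stein–Wuthrich Thm. 6.1 (`hJn`) — via
`X2.bsdp_of_cellC_of_not_split_of_mazurMainConjectureAt_of_schneider` (height existence `hHn`,
Gross–Zagier `hGZ`, GZK, modularity `hpar`), granted the pair's Schneider certificate `hSch`. ALL
class-level inputs PUBLISHED; per pair: certificates only. [cite: CastellaGrossiSkinner2025, Theorem A]
[cite: GreenbergVatsal2000, Thm. (1.4), §1 (5)–(7), pp. 14–15, §2 pp. 20–27]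
[cite: Wuthrich2014, Thm. 16 (p. 397)] [cite: Disegni2020, Thm. 4 (§3.2)]
[cite: SteinWuthrich2013, Thm. 6.1 (p. 20), §3.1 (p. 9), §4.2] -/
theorem bsdp_of_coveredRelative_rankOne_of_not_split (hA : thmA_charIdeal_eq_padicLFunction)
    (hWu : thm16_charIdeal_dvd_multiplicative_of_reducible)
    (hW16 : Wuthrich2014.charIdeal_dvd_padicLFunction)
    (hDis : padicBSD_rankOne_nonsplitMult) (hJn : thm61_nonsplitMultiplicative)
    (hHn : exists_isMultCanonical) (hGZ : GrossZagier1986_thm_I_7_3)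
    (hGZK : rank_eq_analyticRank_of_analyticRank_le_one)
    (hpar : nonempty_modularParametrizationData)
    (hT : Silverman1994_thmV53_corV54_tateUniformisation.{0})
    (hT' : Silverman1994_thmV53_tateUniformisation.{0})
    (hAm : lambda_nonPrimitive_eq_add_sum_delta_multiplicative)
    (hBm : datumSelmer_divisible_of_finite_torsionBy) (hF : datumStrictSelmer_lt_datumSelmer_of_split)
    (hGV : imKummer_ge_greenbergCondition_at_p) (hA7 : lambda_nonPrimitive_eq_add_sum_delta)
    (hB : divisible_nonPrimitiveSelmerInfty_of_mu_eq_zero)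
    (hp2 : p ≠ 2) (hmult : W.HasMultiplicativeReductionAtPrime p)
    (hns : ¬ W.HasSplitMultiplicativeReductionAtPrime p)
    (hred : ¬ W.HasIrreducibleModPGaloisRep p) (hr : W.analyticRank = 1) {n : ℕ}
    (hμ0 : AnalyticMuLE W p 0) (hlam : AnalyticLambdaEq W p n)
    (hgood' : W'.HasGoodReductionAtPrime p)
    (hna' : ¬ (p : ℤ) ∣ W'.frobeniusTrace p - 1) {n' : ℕ}
    (hμ0' : X1.MuPart.AnalyticMuLE W' p 0) (hlam' : X1.ParitySqueeze.AnalyticLambdaEq W' p n')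
    (hS₀ : ∀ v ∈ S₀, ((p : ℕ) : 𝓞 ℚ) ∉ v.asIdeal)
    (hS : ∀ v : HeightOneSpectrum (𝓞 ℚ), v ∉ S₀ → ((p : ℕ) : 𝓞 ℚ) ∉ v.asIdeal →
      W.HasGoodReductionAt v)
    (hS' : ∀ v : HeightOneSpectrum (𝓞 ℚ), v ∉ S₀ → ((p : ℕ) : 𝓞 ℚ) ∉ v.asIdeal →
      W'.HasGoodReductionAt v)
    (hiso : TorsionIso W W' p) {k : ℕ}
    (hk : (k : ℤ) = n' + ∑ v ∈ S₀, ((delta W' p v : ℤ) - (delta W p v : ℤ))) (hn : n ≤ k)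
    (hSch : ∀ (q : ℚ_[p]) (Dh : PAdicHeightData W p), q ≠ 0 → ‖q‖ < 1 → tateJ q = (W.j : ℚ_[p]) →
      IsMultCanonical Dh q → SchneiderConjecture Dh) :
    BSDp W p :=
  bsdp_of_cellC_of_not_split_of_mazurMainConjectureAt_of_schneider W p hDis hJn hHn hGZ hGZK hpar
    ⟨hr, hp2, hred, hmult⟩ hns
    (mazurMainConjectureAt_of_coveredRelative_of_not_split S₀ hA hWu hW16 hpar hT hT' hAm hBm hF hGV
      hA7 hB hp2 hmult hns hred hμ0 hlam hgood' hna' hμ0' hlam' hS₀ hS hS' hiso hk hn)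
    hSch

end NonSplitRankOne

end Summit.BirchSwinnertonDyer.Rank1Residual.X2

end
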